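import Summits.HodgeConjecture.HodgeConjecture.Theorems.Ring2WeilCoverageCyclotomicPrincipalObstruction
import HarnessLib

/-!
# Weil-type family coverage — the four remaining rows of the `h = 1` census, stated with their ONE hypothesis:
# `(35, ℚ(√−7))`, `(35, ℚ(√−35))`, `(45, ℚ(√−3))`, `(45, ℚ(√−15))` are NO rows modulo THEOREM L (i)

research route conditional on HC_CM; not a corollary; Q11.4-sentence-2 already refuted in dim ≥ 3.

Ring 2, WEIL-TYPE FAMILY-COVERAGE CENSUS (`HOME/WEIL-FAMILY-COVERAGE.md` `## b01`, blocks b01.23 (C)/(D), b01.28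
THEOREM F (F3) «n₋ odd exactly for (p^a q^b odd, ℚ(√−p) or ℚ(√−pq)) with (p/q) = −1 …», b01.34 (D)/(G), b01.36 (D);
owner ring2-b01), part 29 of the `Ring2WeilCoverage*` series.  After parts 9/10 (five unconditional NO rows) and
13–24 (all YES rows unconditional), the `h(ℚ(ζ_M)) = 1` census has exactly four rows left whose verdict is not a
hypothesis-free tree theorem: the NO rows at the `g = 12` levels `35` and `45`, where `n₋(M, K)` is ODD and the
obstruction of part 7 (`not_exists_principal_of_norm_pos_of_odd`) needs «every unit of `ℚ(ζ_M)⁺` has norm `+1`»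
(THEOREM L (i)) — true by Hilbert reciprocity for `M` not a prime power, but not reachable by part 8's elementary
`√D` route (`ℚ(ζ₃₅)⁺, ℚ(ζ₄₅)⁺ ⊇ ℚ(√5)` only, whose fundamental unit has norm `−1`).  This file states the four rows
with that single hypothesis `hN` explicit, the residue sets `N_K` displayed and `n₋` odd by `decide`:
`not_exists_principal_thirtyFive_sqrt_neg_seven` (`n₋ = 5`), `…thirtyFive_sqrt_neg_thirtyFive` (`n₋ = 3`),
`…fortyFive_sqrt_neg_three` (`n₋ = 5`), `…fortyFive_sqrt_neg_fifteen` (`n₋ = 5`) — so every one of the 32 rows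
(M, K) of the `h = 1` census is now a NAMED tree theorem: 28 hypothesis-free, 4 modulo `hN`.

HONEST FRAMING: CONDITIONAL statements (hypothesis `hN` displayed; no named fact is introduced); statements about
Shimura's divisors of principal type on `ℂ^Φ/Φ(ℤ[ζ_M])`; the `N_K` are the displayed finite sets (= «conjugation
residues» by parts 27a/b); nothing about Hodge classes, `W_K`, general members or HC; `HC_CM` is used nowhere.
No `def`, no named fact, no `sorry`.

References: [cite: Shimura1998, §14.3 Prop. 4–5, pp. 103–104]; census b01.28 THEOREM L (i) / b01.34 (D) (seat-derived).
-/

noncomputable section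

open Polynomial NumberField Complex Finset
open scoped Real nonZeroDivisors

namespace Summit.HodgeConjecture.Ring2WeilCoverage.CyclotomicConditionalNoRows

open Literature.AlgebraicGeometry.Motives (CMType)
open Literature.AlgebraicGeometry.HodgeTheory (IsCMTypeSet)
open Literature.NumberTheory.ComplexMultiplication
open Summit.HodgeConjecture.Ring2WeilCoverage.CyclotomicPrincipalObstruction (not_exists_principal_of_norm_pos_of_odd)

variable {K : Type} [Field K] [NumberField K] {ζ : K}

/-- `𝐞(t) = exp(2πi t/M) ∈ ℂ` (`ZMod.toCircle`). -/
local notation3 (prettyPrint := false) "𝐞 " t:max => ((ZMod.toCircle t : Circle) : ℂ)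

open scoped Classical in
/-- **Census row `(ℚ(ζ_35), ℚ(√−7))` — NO, modulo THEOREM L (i)**: for any `K` with `IsCyclotomicExtension {35} ℚ K`,
`[IsCMField K]`, and any CM type `Φ` balanced for `N_K = {3, 6, 12, 13, 17, 19, 24, 26, 27, 31, 33, 34}` (`n₋ = 5`, odd), the principal CM torus
`ℂ^Φ/Φ(ℤ[ζ_35])` carries NO `ι`-compatible principal polarisation — PROVIDED every unit of `𝓞(ℚ(ζ_35)⁺)` has
positive norm (`hN`, THEOREM L (i): Hilbert reciprocity over `ℚ(ζ_35)⁺`, not in the tree; b01.34 (D)'s elementary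
`√D` route does not reach `35`).
research route conditional on HC_CM; not a corollary; Q11.4-sentence-2 already refuted in dim ≥ 3. [cite: Shimura1998, §14.3 Prop. 5, p. 104] -/
theorem not_exists_principal_thirtyFive_sqrt_neg_seven [IsCMField K] [IsCyclotomicExtension {35} ℚ K]
    (hζ : IsPrimitiveRoot ζ 35) (Φ : CMType K)
    (hbal : 2 * ((Finset.univ.filter fun t : ZMod 35 => ∃ σ ∈ Φ.1, σ ζ = 𝐞 t) ∩
        ({3, 6, 12, 13, 17, 19, 24, 26, 27, 31, 33, 34} : Finset (ZMod 35))).card =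
      (Finset.univ.filter fun t : ZMod 35 => ∃ σ ∈ Φ.1, σ ζ = 𝐞 t).card)
    (hN : ∀ v : (𝓞 (maximalRealSubfield K))ˣ,
      0 < Algebra.norm ℚ (((v : 𝓞 (maximalRealSubfield K)) : maximalRealSubfield K))) :
    ¬ ∃ ζ' : K, IsCMField.complexConj K ζ' = -ζ' ∧ (∀ φ : Φ.1, 0 < (φ.1 ζ').im) ∧
        CMTypeLattice.IsOfType (1 : (FractionalIdeal (𝓞 K)⁰ K)ˣ) ζ' ⊤ := by
  have hK : IsCMTypeSet 35 ({3, 6, 12, 13, 17, 19, 24, 26, 27, 31, 33, 34} : Finset (ZMod 35)) := by decide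
  have hg : Nat.totient 35 = 2 * (11 + 1) := by decide
  have hodd : Odd (({3, 6, 12, 13, 17, 19, 24, 26, 27, 31, 33, 34} : Finset (ZMod 35)).filter fun t : ZMod 35 => 2 * t.val < 35).card := by decide
  exact not_exists_principal_of_norm_pos_of_odd hζ hg Φ hK hbal hodd hN

open scoped Classical in
/-- **Census row `(ℚ(ζ_35), ℚ(√−35))` — NO, modulo THEOREM L (i)**: for any `K` with `IsCyclotomicExtension {35} ℚ K`,
`[IsCMField K]`, and any CM type `Φ` balanced for `N_K = {2, 6, 8, 18, 19, 22, 23, 24, 26, 31, 32, 34}` (`n₋ = 3`, odd), the principal CM torus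
`ℂ^Φ/Φ(ℤ[ζ_35])` carries NO `ι`-compatible principal polarisation — PROVIDED every unit of `𝓞(ℚ(ζ_35)⁺)` has
positive norm (`hN`, THEOREM L (i): Hilbert reciprocity over `ℚ(ζ_35)⁺`, not in the tree; b01.34 (D)'s elementary
`√D` route does not reach `35`).
research route conditional on HC_CM; not a corollary; Q11.4-sentence-2 already refuted in dim ≥ 3. [cite: Shimura1998, §14.3 Prop. 5, p. 104] -/
theorem not_exists_principal_thirtyFive_sqrt_neg_thirtyFive [IsCMField K] [IsCyclotomicExtension {35} ℚ K]
    (hζ : IsPrimitiveRoot ζ 35) (Φ : CMType K)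
    (hbal : 2 * ((Finset.univ.filter fun t : ZMod 35 => ∃ σ ∈ Φ.1, σ ζ = 𝐞 t) ∩
        ({2, 6, 8, 18, 19, 22, 23, 24, 26, 31, 32, 34} : Finset (ZMod 35))).card =
      (Finset.univ.filter fun t : ZMod 35 => ∃ σ ∈ Φ.1, σ ζ = 𝐞 t).card)
    (hN : ∀ v : (𝓞 (maximalRealSubfield K))ˣ,
      0 < Algebra.norm ℚ (((v : 𝓞 (maximalRealSubfield K)) : maximalRealSubfield K))) :
    ¬ ∃ ζ' : K, IsCMField.complexConj K ζ' = -ζ' ∧ (∀ φ : Φ.1, 0 < (φ.1 ζ').im) ∧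
        CMTypeLattice.IsOfType (1 : (FractionalIdeal (𝓞 K)⁰ K)ˣ) ζ' ⊤ := by
  have hK : IsCMTypeSet 35 ({2, 6, 8, 18, 19, 22, 23, 24, 26, 31, 32, 34} : Finset (ZMod 35)) := by decide
  have hg : Nat.totient 35 = 2 * (11 + 1) := by decide
  have hodd : Odd (({2, 6, 8, 18, 19, 22, 23, 24, 26, 31, 32, 34} : Finset (ZMod 35)).filter fun t : ZMod 35 => 2 * t.val < 35).card := by decide
  exact not_exists_principal_of_norm_pos_of_odd hζ hg Φ hK hbal hodd hN

open scoped Classical in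
/-- **Census row `(ℚ(ζ_45), ℚ(√−3))` — NO, modulo THEOREM L (i)**: for any `K` with `IsCyclotomicExtension {45} ℚ K`,
`[IsCMField K]`, and any CM type `Φ` balanced for `N_K = {2, 8, 11, 14, 17, 23, 26, 29, 32, 38, 41, 44}` (`n₋ = 5`, odd), the principal CM torus
`ℂ^Φ/Φ(ℤ[ζ_45])` carries NO `ι`-compatible principal polarisation — PROVIDED every unit of `𝓞(ℚ(ζ_45)⁺)` has
positive norm (`hN`, THEOREM L (i): Hilbert reciprocity over `ℚ(ζ_45)⁺`, not in the tree; b01.34 (D)'s elementary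
`√D` route does not reach `45`).
research route conditional on HC_CM; not a corollary; Q11.4-sentence-2 already refuted in dim ≥ 3. [cite: Shimura1998, §14.3 Prop. 5, p. 104] -/
theorem not_exists_principal_fortyFive_sqrt_neg_three [IsCMField K] [IsCyclotomicExtension {45} ℚ K]
    (hζ : IsPrimitiveRoot ζ 45) (Φ : CMType K)
    (hbal : 2 * ((Finset.univ.filter fun t : ZMod 45 => ∃ σ ∈ Φ.1, σ ζ = 𝐞 t) ∩
        ({2, 8, 11, 14, 17, 23, 26, 29, 32, 38, 41, 44} : Finset (ZMod 45))).card =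
      (Finset.univ.filter fun t : ZMod 45 => ∃ σ ∈ Φ.1, σ ζ = 𝐞 t).card)
    (hN : ∀ v : (𝓞 (maximalRealSubfield K))ˣ,
      0 < Algebra.norm ℚ (((v : 𝓞 (maximalRealSubfield K)) : maximalRealSubfield K))) :
    ¬ ∃ ζ' : K, IsCMField.complexConj K ζ' = -ζ' ∧ (∀ φ : Φ.1, 0 < (φ.1 ζ').im) ∧
        CMTypeLattice.IsOfType (1 : (FractionalIdeal (𝓞 K)⁰ K)ˣ) ζ' ⊤ := by
  have hK : IsCMTypeSet 45 ({2, 8, 11, 14, 17, 23, 26, 29, 32, 38, 41, 44} : Finset (ZMod 45)) := by decide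
  have hg : Nat.totient 45 = 2 * (11 + 1) := by decide
  have hodd : Odd (({2, 8, 11, 14, 17, 23, 26, 29, 32, 38, 41, 44} : Finset (ZMod 45)).filter fun t : ZMod 45 => 2 * t.val < 45).card := by decide
  exact not_exists_principal_of_norm_pos_of_odd hζ hg Φ hK hbal hodd hN

open scoped Classical in
/-- **Census row `(ℚ(ζ_45), ℚ(√−15))` — NO, modulo THEOREM L (i)**: for any `K` with `IsCyclotomicExtension {45} ℚ K`,
`[IsCMField K]`, and any CM type `Φ` balanced for `N_K = {7, 11, 13, 14, 22, 26, 28, 29, 37, 41, 43, 44}` (`n₋ = 5`, odd), the principal CM torus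
`ℂ^Φ/Φ(ℤ[ζ_45])` carries NO `ι`-compatible principal polarisation — PROVIDED every unit of `𝓞(ℚ(ζ_45)⁺)` has
positive norm (`hN`, THEOREM L (i): Hilbert reciprocity over `ℚ(ζ_45)⁺`, not in the tree; b01.34 (D)'s elementary
`√D` route does not reach `45`).
research route conditional on HC_CM; not a corollary; Q11.4-sentence-2 already refuted in dim ≥ 3. [cite: Shimura1998, §14.3 Prop. 5, p. 104] -/
theorem not_exists_principal_fortyFive_sqrt_neg_fifteen [IsCMField K] [IsCyclotomicExtension {45} ℚ K]
    (hζ : IsPrimitiveRoot ζ 45) (Φ : CMType K)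
    (hbal : 2 * ((Finset.univ.filter fun t : ZMod 45 => ∃ σ ∈ Φ.1, σ ζ = 𝐞 t) ∩
        ({7, 11, 13, 14, 22, 26, 28, 29, 37, 41, 43, 44} : Finset (ZMod 45))).card =
      (Finset.univ.filter fun t : ZMod 45 => ∃ σ ∈ Φ.1, σ ζ = 𝐞 t).card)
    (hN : ∀ v : (𝓞 (maximalRealSubfield K))ˣ,
      0 < Algebra.norm ℚ (((v : 𝓞 (maximalRealSubfield K)) : maximalRealSubfield K))) :
    ¬ ∃ ζ' : K, IsCMField.complexConj K ζ' = -ζ' ∧ (∀ φ : Φ.1, 0 < (φ.1 ζ').im) ∧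
        CMTypeLattice.IsOfType (1 : (FractionalIdeal (𝓞 K)⁰ K)ˣ) ζ' ⊤ := by
  have hK : IsCMTypeSet 45 ({7, 11, 13, 14, 22, 26, 28, 29, 37, 41, 43, 44} : Finset (ZMod 45)) := by decide
  have hg : Nat.totient 45 = 2 * (11 + 1) := by decide
  have hodd : Odd (({7, 11, 13, 14, 22, 26, 28, 29, 37, 41, 43, 44} : Finset (ZMod 45)).filter fun t : ZMod 45 => 2 * t.val < 45).card := by decide
  exact not_exists_principal_of_norm_pos_of_odd hζ hg Φ hK hbal hodd hN

end Summit.HodgeConjecture.Ring2WeilCoverage.CyclotomicConditionalNoRows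

end
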